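import Mathlib
import Summits.Ventures.PercRepro.TriangleCapEqualityLocusLine

/-!
# PercRepro — THE HANG FAMILY: a cubic core of six vertices with every other vertex hung on one pair
(p3, gen 42; part 172)

The recursion `line_eq_iff` of part 171 describes the extremal graphs of the line `k − r = 6` (the cells
`(k, 3, k − 6)`, `m = 2k − 3` edges, `Σ_v d(v)² = m k − 5 (k − 6)`) as the star-shaped graphs and the
HANGINGS of the extremal graphs one step down.  Unrolled (parts 173–174), the hangings form ONE explicit
family: `HangOn D C x y` — a six-set `C` on which `D` is cubic (every vertex of `C` has exactly three
neighbours inside `C`), a pair `x ≠ y` in `C`, and every vertex off `C` adjacent exactly to `x` and `y`.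
This module is the family and its counts: the degrees (`deg_of_hangOn_mem`, `deg_of_hangOn_not_mem`:
`k − 3` at `x` and `y`, `3` on the rest of the core, `2` off the core), `Σ_v d(v)² = 2 (k−3)² + 36 + 4 (k−6)`
(`sum_deg_sq_of_hangOn`), and the consequence that every member of the family with `2k − 3` edges is
extremal on the line (`line_eq_of_hangFamily`).  Axioms: standard.
-/

namespace PercRepro

namespace TriangleCap

namespace C047

open Finset

variable {V : Type*} [Fintype V] [DecidableEq V]

omit [Fintype V] [DecidableEq V] in
/-- **THE HANG FAMILY on the core `C` with the pair `x, y`:** `C` has six vertices, `D` is cubic on `C`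
(every vertex of `C` has exactly three neighbours in `C`), `x ≠ y` lie in `C`, and every vertex off `C` is
adjacent exactly to `x` and `y`. -/
def HangOn (D : SimpleGraph V) [DecidableRel D.Adj] (C : Finset V) (x y : V) : Prop :=
  C.card = 6 ∧ x ∈ C ∧ y ∈ C ∧ x ≠ y ∧ (∀ c ∈ C, degIn D C c = 3) ∧
    (∀ z, z ∉ C → ∀ w, D.Adj z w ↔ (w = x ∨ w = y))

omit [Fintype V] [DecidableEq V] in
/-- **THE HANG FAMILY:** some cubic six-core with all the other vertices hung on one of its pairs. -/
def HangFamily (D : SimpleGraph V) [DecidableRel D.Adj] : Prop := ∃ (C : Finset V) (x y : V), HangOn D C x y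

omit [DecidableEq V] in
/-- A hang family graph has at least six vertices (the core). -/
theorem six_le_card_of_hangOn (D : SimpleGraph V) [DecidableRel D.Adj] {C : Finset V} {x y : V}
    (h : HangOn D C x y) : 6 ≤ Fintype.card V :=
  h.1 ▸ card_le_univ C

/-- The degree of a core vertex: `3` plus `k − 6` at `x` and at `y`. -/
theorem deg_of_hangOn_mem (D : SimpleGraph V) [DecidableRel D.Adj] {C : Finset V} {x y : V}
    (h : HangOn D C x y) {c : V} (hc : c ∈ C) :
    deg D c = 3 + (if c = x ∨ c = y then Fintype.card V - 6 else 0) := by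
  obtain ⟨hC, -, -, -, hcub, hout⟩ := h
  rw [deg_eq_sum_boole, ← sum_add_sum_compl C]
  have h1 : ∑ w ∈ C, (if D.Adj c w then 1 else 0) = 3 := by
    rw [← card_filter]
    exact hcub c hc
  have h2 : ∑ w ∈ Cᶜ, (if D.Adj c w then 1 else 0) = if c = x ∨ c = y then Fintype.card V - 6 else 0 := by
    have hpt : ∀ w ∈ Cᶜ, (if D.Adj c w then 1 else 0) = if c = x ∨ c = y then 1 else 0 := by
      intro w hw
      rw [mem_compl] at hw
      have hiff : D.Adj c w ↔ (c = x ∨ c = y) := (D.adj_comm c w).trans (hout w hw c)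
      by_cases h1 : D.Adj c w
      · rw [if_pos h1, if_pos (hiff.mp h1)]
      · rw [if_neg h1, if_neg (fun h2 => h1 (hiff.mpr h2))]
    rw [sum_congr rfl hpt]
    split_ifs
    · rw [sum_const, smul_eq_mul, mul_one, card_compl, hC]
    · exact sum_const_zero
  rw [h1, h2]

/-- The degree of a vertex off the core: `2` (its neighbours are `x` and `y`). -/
theorem deg_of_hangOn_not_mem (D : SimpleGraph V) [DecidableRel D.Adj] {C : Finset V} {x y : V}
    (h : HangOn D C x y) {z : V} (hz : z ∉ C) : deg D z = 2 := by
  obtain ⟨-, -, -, hxy, -, hout⟩ := h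
  unfold deg
  have hN : univ.filter (fun w => D.Adj z w) = {x, y} := by
    ext w
    simp only [mem_filter, mem_univ, true_and, mem_insert, mem_singleton]
    exact hout z hz w
  rw [hN, card_pair hxy]

/-- The degree of `x` and of `y`: `k − 3`. -/
theorem deg_of_hangOn_pair (D : SimpleGraph V) [DecidableRel D.Adj] {C : Finset V} {x y : V}
    (h : HangOn D C x y) : deg D x + 3 = Fintype.card V ∧ deg D y + 3 = Fintype.card V := by
  have hk := six_le_card_of_hangOn D h
  constructor
  · rw [deg_of_hangOn_mem D h h.2.1]
    simp only [true_or, if_true]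
    omega
  · rw [deg_of_hangOn_mem D h h.2.2.1]
    simp only [or_true, if_true]
    omega

/-- **THE DEGREE SQUARES OF A HANG FAMILY GRAPH:** `Σ_v d(v)² = 2 (k − 3)² + 4·9 + (k − 6)·4`. -/
theorem sum_deg_sq_of_hangOn (D : SimpleGraph V) [DecidableRel D.Adj] {C : Finset V} {x y : V}
    (h : HangOn D C x y) :
    ∑ v, deg D v * deg D v =
      2 * ((Fintype.card V - 3) * (Fintype.card V - 3)) + 36 + (Fintype.card V - 6) * 4 := by
  have hk := six_le_card_of_hangOn D h
  obtain ⟨hC, hx, hy, hxy, -, -⟩ := id h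
  rw [← sum_add_sum_compl C]
  have hout' : ∑ v ∈ Cᶜ, deg D v * deg D v = (Fintype.card V - 6) * 4 := by
    rw [sum_congr rfl (fun v hv => by rw [deg_of_hangOn_not_mem D h (mem_compl.mp hv)]), sum_const,
      card_compl, hC, smul_eq_mul]
  have hyx : y ∈ C.erase x := mem_erase.mpr ⟨hxy.symm, hy⟩
  have hin : ∑ v ∈ C, deg D v * deg D v = 2 * ((Fintype.card V - 3) * (Fintype.card V - 3)) + 36 := by
    rw [← add_sum_erase C _ hx, ← add_sum_erase (C.erase x) _ hyx]
    have hdx : deg D x = Fintype.card V - 3 := by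
      rw [deg_of_hangOn_mem D h hx]
      simp only [true_or, if_true]
      omega
    have hdy : deg D y = Fintype.card V - 3 := by
      rw [deg_of_hangOn_mem D h hy]
      simp only [or_true, if_true]
      omega
    have hrest : ∑ v ∈ (C.erase x).erase y, deg D v * deg D v = 36 := by
      have hpt : ∀ v ∈ (C.erase x).erase y, deg D v * deg D v = 9 := by
        intro v hv
        rw [mem_erase, mem_erase] at hv
        rw [deg_of_hangOn_mem D h hv.2.2]
        have hne : ¬ (v = x ∨ v = y) := by
          rintro (h1 | h1)
          · exact hv.2.1 h1
          · exact hv.1 h1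
        simp only [hne, if_false]
      rw [sum_congr rfl hpt, sum_const, smul_eq_mul, card_erase_of_mem hyx, card_erase_of_mem hx, hC]
    rw [hdx, hdy, hrest]
    ring
  rw [hin, hout']

/-- **A HANG FAMILY GRAPH WITH `2k − 3` EDGES IS EXTREMAL ON THE LINE:** `Σ_v d(v)² + 5 (k − 6) = m k`. -/
theorem line_eq_of_hangFamily (D : SimpleGraph V) [DecidableRel D.Adj]
    (hm : D.edgeFinset.card + 3 = 2 * Fintype.card V) (h : HangFamily D) :
    ∑ v, deg D v * deg D v + (Fintype.card V - 6) * 5 = D.edgeFinset.card * Fintype.card V := by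
  obtain ⟨C, x, y, h⟩ := h
  have hk := six_le_card_of_hangOn D h
  rw [sum_deg_sq_of_hangOn D h]
  obtain ⟨k', hk'⟩ : ∃ k', Fintype.card V = k' + 6 := ⟨Fintype.card V - 6, by omega⟩
  rw [hk'] at hm ⊢
  have e1 : k' + 6 - 3 = k' + 3 := by omega
  have e2 : k' + 6 - 6 = k' := by omega
  have hmD : D.edgeFinset.card = 2 * k' + 9 := by omega
  rw [e1, e2, hmD]
  ring

end C047

end TriangleCap

end PercRepro
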